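import Summits.QuantumFields.YangMills.Theorems.IsotropyFromPowerCountingTemperedCurvatureMomentsThreePointChartBoundsTwoPoint

/-!
# Three-point chart bounds III: the translation identity and the norm of derived one-point vectors

Support file for stub `stub_threePointChartBounds` (B) of reshape 4 of
`Cruxes/TemperedCurvatureMoments/Lines/Sketch.lean` (crux stmt-QuantumFields-17721, line `Sketch`).
`T(∂_{(w,…,w)} F) = 0` for functionals translation invariant on `⁰𝒮`; hence `T(∂_wᴺ u ⊗ v) = (−1)ᴺ T(u ⊗ ∂_wᴺ v)`
for disjointly supported factors; derivatives commute with `conj` and `θ`; and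
`‖Ψ_{∂_wᴺ g}‖² ≤ |𝔖₂(θq̄ ⊗ q)| = |𝔖₂(θḡ ⊗ ∂_w^{2N} g)| ≤ (2N/(e δ/2))^{2N} K |g|²`.
References: Osterwalder–Schrader, Comm. Math. Phys. 31 (1973) §4.1, 42 (1975) §4; Glimm–Jaffe, Quantum
Physics (1987) Thm. 6.1.3, §19.5. [folklore]
-/

noncomputable section

open scoped InnerProductSpace ComplexConjugate
open MeasureTheory Filter Set Complex
open _root_.Topology
open Literature.MathematicalPhysics.AQFT Literature.MathematicalPhysics.QuantumLattice
open Literature.MathematicalPhysics.QuantumFieldTheory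
open scoped SchwartzMap LineDeriv
open Literature.MathematicalPhysics.QuantumLattice.SchwingerFamily (timeVec)
open Summit.QuantumFields.YangMills.Theorems.CurvatureKernel
open Summit.QuantumFields.YangMills.Cruxes.PlanarSpectralCone.TwoMirrorLightconeSlots.DiscSections (translateMulti_time_space)

namespace Summit.QuantumFields.YangMills.Theorems.TemperedCurvatureMoments.Sketch.ThreePointChartBounds

/-! ## The translation identity: derivatives move across a two-point tensor -/

section TranslationIdentity

variable {n : ℕ}

/-- **A functional that is translation invariant on `⁰𝒮` kills diagonal derivatives**: for
`F ∈ ⁰𝒮ₙ` and any `w`, `T (∂_{(w,…,w)} F) = 0` (the translation orbit `s ↦ T(F(· − s(w,…,w)))` is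
constant and differentiable). [folklore] -/
theorem apply_lineDerivOp_const_eq_zero (T : 𝓢((Fin n → EuclideanSpace ℝ (Fin 4)), ℂ) →L[ℂ] ℂ)
    (hT : ∀ (a : EuclideanSpace ℝ (Fin 4)) (F : 𝓢((Fin n → EuclideanSpace ℝ (Fin 4)), ℂ)),
      IsOffDiagonal F → T (translateMulti a F) = T F)
    (w : EuclideanSpace ℝ (Fin 4)) {X : 𝓢((Fin n → EuclideanSpace ℝ (Fin 4)), ℂ)} (hX : IsOffDiagonal X) :
    T (∂_{(fun _ : Fin n => w)} X) = 0 := by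
  have hconst : ∀ s : ℝ,
      T (SchwartzMap.compSubConstCLM ℂ (s • (fun _ : Fin n => w)) X) = T X := by
    intro s
    have h1 : SchwartzMap.compSubConstCLM ℂ (s • (fun _ : Fin n => w)) X = translateMulti (s • w) X := by
      ext x
      rfl
    rw [h1, hT _ _ hX]
  have h1 := hasDerivAt_apply_compSubConstCLM_smul T X (fun _ : Fin n => w) 0
  rw [zero_smul, SchwartzMap.compSubConstCLM_zero, ContinuousLinearMap.id_apply] at h1
  have h2 : HasDerivAt (fun s : ℝ => T (SchwartzMap.compSubConstCLM ℂ (s • (fun _ : Fin n => w)) X))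
      0 0 := by
    have h3 : (fun s : ℝ => T (SchwartzMap.compSubConstCLM ℂ (s • (fun _ : Fin n => w)) X)) =
        fun _ => T X := funext hconst
    rw [h3]
    exact hasDerivAt_const 0 (T X)
  exact neg_eq_zero.1 (h1.unique h2)

/-- The Leibniz rule along a diagonal direction of a two-point tensor:
`∂_{(w,w)} (u ⊗ v) = ∂_w u ⊗ v + u ⊗ ∂_w v`. [folklore] -/
theorem lineDerivOp_const_tensorFin_two (w : EuclideanSpace ℝ (Fin 4))
    (u v : 𝓢(EuclideanSpace ℝ (Fin 4), ℂ)) :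
    (∂_{(fun _ : Fin 2 => w)} (SchwartzMap.tensorFin 2 ![u, v]) :
        𝓢((Fin 2 → EuclideanSpace ℝ (Fin 4)), ℂ)) =
      SchwartzMap.tensorFin 2 ![∂_{w} u, v] + SchwartzMap.tensorFin 2 ![u, ∂_{w} v] := by
  have hW : (fun _ : Fin 2 => w) = (Pi.single 0 w : Fin 2 → EuclideanSpace ℝ (Fin 4)) + Pi.single 1 w := by
    ext i j
    fin_cases i <;> simp
  rw [hW, LineDerivAdd.lineDerivOp_left_add, lineDerivOp_single_zero_tensorFin_two,
    lineDerivOp_single_one_tensorFin_two]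

/-- **Integration by parts across a two-point tensor**: for a functional translation invariant on
`⁰𝒮` and factors with disjoint supports, `T(∂_w u ⊗ v) = −T(u ⊗ ∂_w v)`. [folklore] -/
theorem apply_tensorFin_two_lineDerivOp_left (T : 𝓢((Fin 2 → EuclideanSpace ℝ (Fin 4)), ℂ) →L[ℂ] ℂ)
    (hT : ∀ (a : EuclideanSpace ℝ (Fin 4)) (F : 𝓢((Fin 2 → EuclideanSpace ℝ (Fin 4)), ℂ)),
      IsOffDiagonal F → T (translateMulti a F) = T F)
    (w : EuclideanSpace ℝ (Fin 4)) {u v : 𝓢(EuclideanSpace ℝ (Fin 4), ℂ)}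
    (huv : Disjoint (tsupport (u : EuclideanSpace ℝ (Fin 4) → ℂ)) (tsupport (v : EuclideanSpace ℝ (Fin 4) → ℂ))) :
    T (SchwartzMap.tensorFin 2 ![∂_{w} u, v]) = -T (SchwartzMap.tensorFin 2 ![u, ∂_{w} v]) := by
  have h0 := apply_lineDerivOp_const_eq_zero T hT w (isOffDiagonal_tensorFin_two_of_disjoint huv)
  rw [lineDerivOp_const_tensorFin_two, map_add] at h0
  exact eq_neg_of_add_eq_zero_left h0

/-- Iterated form: `T(∂_wᴺ u ⊗ v) = (−1)ᴺ T(u ⊗ ∂_wᴺ v)` for factors with disjoint supports. [folklore] -/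
theorem apply_tensorFin_two_iterate_lineDerivOp_left
    (T : 𝓢((Fin 2 → EuclideanSpace ℝ (Fin 4)), ℂ) →L[ℂ] ℂ)
    (hT : ∀ (a : EuclideanSpace ℝ (Fin 4)) (F : 𝓢((Fin 2 → EuclideanSpace ℝ (Fin 4)), ℂ)),
      IsOffDiagonal F → T (translateMulti a F) = T F)
    (w : EuclideanSpace ℝ (Fin 4)) (N : ℕ) :
    ∀ {u v : 𝓢(EuclideanSpace ℝ (Fin 4), ℂ)},
      Disjoint (tsupport (u : EuclideanSpace ℝ (Fin 4) → ℂ)) (tsupport (v : EuclideanSpace ℝ (Fin 4) → ℂ)) →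
      T (SchwartzMap.tensorFin 2 ![((∂_{w} : 𝓢(EuclideanSpace ℝ (Fin 4), ℂ) →
          𝓢(EuclideanSpace ℝ (Fin 4), ℂ))^[N] u), v]) =
        (-1 : ℂ) ^ N * T (SchwartzMap.tensorFin 2 ![u, ((∂_{w} : 𝓢(EuclideanSpace ℝ (Fin 4), ℂ) →
          𝓢(EuclideanSpace ℝ (Fin 4), ℂ))^[N] v)]) := by
  induction N with
  | zero => intro u v _; simp
  | succ N ih =>
    intro u v huv
    have h1 : Disjoint (tsupport ((∂_{w} u : 𝓢(EuclideanSpace ℝ (Fin 4), ℂ)) : EuclideanSpace ℝ (Fin 4) → ℂ))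
        (tsupport (v : EuclideanSpace ℝ (Fin 4) → ℂ)) :=
      huv.mono_left (SchwartzMap.tsupport_lineDerivOp_subset w u)
    have h2 : Disjoint (tsupport (u : EuclideanSpace ℝ (Fin 4) → ℂ))
        (tsupport ((((∂_{w} : 𝓢(EuclideanSpace ℝ (Fin 4), ℂ) → 𝓢(EuclideanSpace ℝ (Fin 4), ℂ))^[N] v) :
          𝓢(EuclideanSpace ℝ (Fin 4), ℂ)) : EuclideanSpace ℝ (Fin 4) → ℂ)) :=
      huv.mono_right (tsupport_iterate_lineDerivOp_subset w N v)
    rw [Function.iterate_succ_apply, ih h1, apply_tensorFin_two_lineDerivOp_left T hT w h2,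
      ← Function.iterate_succ_apply' (∂_{w} : 𝓢(EuclideanSpace ℝ (Fin 4), ℂ) → 𝓢(EuclideanSpace ℝ (Fin 4), ℂ)),
      pow_succ]
    ring

end TranslationIdentity

/-! ## Conjugation, time reflection and derivatives -/

section StarTheta

variable {X : Type*} [NormedAddCommGroup X] [NormedSpace ℝ X]

/-- `∂_v (conj ∘ f) = conj ∘ ∂_v f`. [folklore] -/
theorem lineDerivOp_starTest (v : X) (f : 𝓢(X, ℂ)) :
    (∂_{v} (starTest f) : 𝓢(X, ℂ)) = starTest (∂_{v} f) := by
  ext x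
  rw [SchwartzMap.lineDerivOp_apply_eq_fderiv, starTest_apply, SchwartzMap.lineDerivOp_apply_eq_fderiv]
  have hfun : ((starTest f : 𝓢(X, ℂ)) : X → ℂ) = fun y => (Complex.conjCLE : ℂ →L[ℝ] ℂ) (f y) := by
    funext y
    simp
  have hd : HasFDerivAt (fun y => (Complex.conjCLE : ℂ →L[ℝ] ℂ) (f y))
      ((Complex.conjCLE : ℂ →L[ℝ] ℂ).comp (fderiv ℝ (f : X → ℂ) x)) x :=
    (Complex.conjCLE : ℂ →L[ℝ] ℂ).hasFDerivAt.comp x (f.differentiableAt).hasFDerivAt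
  rw [hfun, hd.fderiv]
  simp

/-- Iterated form: `(∂_v)^[N] (conj ∘ f) = conj ∘ (∂_v)^[N] f`. [folklore] -/
theorem iterate_lineDerivOp_starTest (v : X) (N : ℕ) (f : 𝓢(X, ℂ)) :
    ((∂_{v} : 𝓢(X, ℂ) → 𝓢(X, ℂ))^[N] (starTest f)) = starTest (((∂_{v} : 𝓢(X, ℂ) → 𝓢(X, ℂ))^[N]) f) := by
  induction N with
  | zero => rfl
  | succ N ih => rw [Function.iterate_succ_apply', ih, lineDerivOp_starTest, Function.iterate_succ_apply']

/-- Iterated derivatives through the time reflection: `(∂_v)^[N] (f ∘ θ) = ((∂_{θv})^[N] f) ∘ θ`. [folklore] -/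
theorem iterate_lineDerivOp_thetaTest (v : EuclideanSpace ℝ (Fin 4)) (N : ℕ)
    (f : 𝓢(EuclideanSpace ℝ (Fin 4), ℂ)) :
    ((∂_{v} : 𝓢(EuclideanSpace ℝ (Fin 4), ℂ) → 𝓢(EuclideanSpace ℝ (Fin 4), ℂ))^[N] (thetaTest 4 f)) =
      thetaTest 4 (((∂_{timeReflection 4 v} : 𝓢(EuclideanSpace ℝ (Fin 4), ℂ) →
        𝓢(EuclideanSpace ℝ (Fin 4), ℂ))^[N]) f) := by
  have h := iterate_lineDerivOp_compCLMOfContinuousLinearEquiv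
    (timeReflection 4).symm.toContinuousLinearEquiv v N f
  have hv : (timeReflection 4).symm.toContinuousLinearEquiv v = timeReflection 4 v := by
    simp
  rw [hv] at h
  exact h

/-- `θ e₁ = e₁`. [folklore] -/
theorem timeReflection_single_one :
    timeReflection 4 (EuclideanSpace.single (1 : Fin 4) (1 : ℝ)) = EuclideanSpace.single (1 : Fin 4) (1 : ℝ) :=
  OSReconstructionNoE1.timeReflection_of_apply_zero (by simp)

/-- `θ e₀ = −e₀`. [folklore] -/
theorem timeReflection_single_zero :
    timeReflection 4 (EuclideanSpace.single (0 : Fin 4) (1 : ℝ)) = -EuclideanSpace.single (0 : Fin 4) (1 : ℝ) := by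
  ext i
  by_cases hi : i = 0
  · subst hi; simp
  · simp [hi]

/-- Positive-time functions reflect to negative-time functions. [folklore] -/
theorem tsupport_starTest_thetaTest_subset_neg {g : 𝓢(EuclideanSpace ℝ (Fin 4), ℂ)} {δ : ℝ}
    (hg : tsupport (g : EuclideanSpace ℝ (Fin 4) → ℂ) ⊆ {y | δ < y 0}) :
    tsupport ((starTest (thetaTest 4 g) : 𝓢(EuclideanSpace ℝ (Fin 4), ℂ)) :
      EuclideanSpace ℝ (Fin 4) → ℂ) ⊆ {y | y 0 < -δ} := by
  intro y hy
  have h := hg (timeReflection_mem_tsupport_of_mem_tsupport_starTest_thetaTest g hy)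
  simp only [mem_setOf_eq, timeReflection_apply, if_true] at h
  show y 0 < -δ
  linarith

end StarTheta

/-! ## The norm of a derived one-point field vector -/

section FieldVecDeriv

/-- **The reflected two-point value of a derived one-point function (explicit constants).**  For `𝔖` with
`h : OSReconstructionNoE1 𝔖.toLabelled`, joint spectral measures on the planar cone and a temperedness bound
`|𝔖₂ F| ≤ C |F|_M`: with `q = ∂_wᴺ g`, `|𝔖₂(conj q∘θ ⊗ q)| ≤ (2N/(e δ/2))^{2N} · 2|C| 4^{M+1} 16^M · |g|_M²`
for every `g` supported in `{y₀ > δ}` (`0 < δ ≤ 1`) and `w ∈ {e₀, e₁}`: the `N` derivatives of the reflected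
factor are moved to the right factor by the translation identity, and the two-point estimate with `2N`
derivatives applies. [folklore] -/
theorem norm_two_point_star_iterate_le (S : SchwingerFamily (EuclideanSpace ℝ (Fin 4)))
    (h : OSReconstructionNoE1 S.toLabelled)
    (hcone : ∀ (ψ : h.Hilbert) (μ : Measure (EuclideanSpace ℝ (Fin 4))),
      h.IsJointSpectralMeasure ψ μ → μ {p | p 0 < |p 1|} = 0)
    (M : ℕ) (C : ℝ) (hS : ∀ F, ‖S 2 F‖ ≤ C * schwartzNorm M F)
    (N : ℕ) {δ : ℝ} (hδ : 0 < δ) (hδ1 : δ ≤ 1)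
    (g : 𝓢(EuclideanSpace ℝ (Fin 4), ℂ)) (hg : tsupport (g : EuclideanSpace ℝ (Fin 4) → ℂ) ⊆ {y | δ < y 0})
    {w : EuclideanSpace ℝ (Fin 4)} (hw : w = EuclideanSpace.single (0 : Fin 4) (1 : ℝ) ∨
      w = EuclideanSpace.single (1 : Fin 4) (1 : ℝ)) :
    ‖S 2 (SchwartzMap.tensorFin 2 ![starTest (thetaTest 4 (((∂_{w} : 𝓢(EuclideanSpace ℝ (Fin 4), ℂ) →
        𝓢(EuclideanSpace ℝ (Fin 4), ℂ))^[N]) g)), ((∂_{w} : 𝓢(EuclideanSpace ℝ (Fin 4), ℂ) →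
        𝓢(EuclideanSpace ℝ (Fin 4), ℂ))^[N]) g])‖ ≤
      ((2 * N : ℕ) / (Real.exp 1 * (δ / 2))) ^ (2 * N) *
        (2 * (|C| * (2 ^ (M + 1)) ^ 2 * 16 ^ M) * schwartzNorm M g ^ 2) := by
  have hT : ∀ (a : EuclideanSpace ℝ (Fin 4)) (F : 𝓢((Fin 2 → EuclideanSpace ℝ (Fin 4)), ℂ)),
      IsOffDiagonal F → S 2 (translateMulti a F) = S 2 F := fun a F hF => by
    have := h.translationInvariant 2 (fun _ => ()) a F hF
    simpa only [SchwingerFamily.toLabelled_apply] using this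
  -- supports
  set u : 𝓢(EuclideanSpace ℝ (Fin 4), ℂ) := starTest (thetaTest 4 g) with hu
  have hu0 : tsupport (u : EuclideanSpace ℝ (Fin 4) → ℂ) ⊆ {y | y 0 < 0} := fun y hy => by
    have h1 := tsupport_starTest_thetaTest_subset_neg hg hy
    simp only [mem_setOf_eq] at h1 ⊢
    linarith
  have hdisj : ∀ K : ℕ, Disjoint (tsupport (u : EuclideanSpace ℝ (Fin 4) → ℂ))
      (tsupport ((((∂_{w} : 𝓢(EuclideanSpace ℝ (Fin 4), ℂ) → 𝓢(EuclideanSpace ℝ (Fin 4), ℂ))^[K] g) :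
        𝓢(EuclideanSpace ℝ (Fin 4), ℂ)) : EuclideanSpace ℝ (Fin 4) → ℂ)) := fun K =>
    Set.disjoint_left.2 fun y hyu hyg => by
      have h1 : y 0 < 0 := hu0 hyu
      have h2 : δ < y 0 := hg (tsupport_iterate_lineDerivOp_subset w K g hyg)
      linarith
  have hstar : starTest (thetaTest 4 (((∂_{w} : 𝓢(EuclideanSpace ℝ (Fin 4), ℂ) →
      𝓢(EuclideanSpace ℝ (Fin 4), ℂ))^[N]) g)) =
      ((∂_{timeReflection 4 w} : 𝓢(EuclideanSpace ℝ (Fin 4), ℂ) → 𝓢(EuclideanSpace ℝ (Fin 4), ℂ))^[N]) u := by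
    rw [hu, iterate_lineDerivOp_starTest, iterate_lineDerivOp_thetaTest, timeReflection_timeReflection]
  rw [hstar]
  -- norms
  have hnu : schwartzNorm M u ≤ schwartzNorm M g := schwartzNorm_starTest_thetaTest_le M g
  have hg0 : 0 ≤ schwartzNorm M g := schwartzNorm_nonneg M g
  have hsq : |C| * (2 ^ (M + 1)) ^ 2 * 16 ^ M * (schwartzNorm M u ^ 2 + schwartzNorm M g ^ 2) ≤
      2 * (|C| * (2 ^ (M + 1)) ^ 2 * 16 ^ M) * schwartzNorm M g ^ 2 := by
    have h4 := schwartzNorm_nonneg M u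
    have hK : 0 ≤ |C| * (2 ^ (M + 1)) ^ 2 * 16 ^ M := by positivity
    nlinarith [mul_le_mul hnu hnu h4 hg0]
  have hw' : timeReflection 4 w = w ∨ timeReflection 4 w = -w := by
    rcases hw with rfl | rfl
    · exact Or.inr timeReflection_single_zero
    · exact Or.inl timeReflection_single_one
  have key : ‖S 2 (SchwartzMap.tensorFin 2 ![((∂_{timeReflection 4 w} : 𝓢(EuclideanSpace ℝ (Fin 4), ℂ) →
      𝓢(EuclideanSpace ℝ (Fin 4), ℂ))^[N]) u, ((∂_{w} : 𝓢(EuclideanSpace ℝ (Fin 4), ℂ) →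
      𝓢(EuclideanSpace ℝ (Fin 4), ℂ))^[N]) g])‖ =
      ‖S 2 (SchwartzMap.tensorFin 2 ![u, ((∂_{w} : 𝓢(EuclideanSpace ℝ (Fin 4), ℂ) →
        𝓢(EuclideanSpace ℝ (Fin 4), ℂ))^[2 * N]) g])‖ := by
    rcases hw' with hw' | hw'
    · rw [hw', apply_tensorFin_two_iterate_lineDerivOp_left (S 2) hT _ N (hdisj N), norm_mul, norm_pow,
        norm_neg, norm_one, one_pow, one_mul, ← Function.iterate_add_apply, ← two_mul]
    · rw [hw', iterate_lineDerivOp_neg, tensorFin_two_smul_left, map_smul, smul_eq_mul, norm_mul, norm_pow,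
        norm_neg, norm_one, one_pow, one_mul,
        apply_tensorFin_two_iterate_lineDerivOp_left (S 2) hT _ N (hdisj N), norm_mul, norm_pow, norm_neg,
        norm_one, one_pow, one_mul, ← Function.iterate_add_apply, ← two_mul]
  rw [key]
  refine (norm_two_point_iterate_le_sum_of_bound S h hcone M C hS (2 * N) hδ hδ1 u g hu0 hg hw).trans ?_
  exact mul_le_mul_of_nonneg_left hsq (by positivity)

/-- **Norms of derived one-point vectors (explicit constants)**: `‖Ψ_{∂_wᴺ g}‖² ≤ |𝔖₂(conj q∘θ ⊗ q)|`
and the previous bound. [folklore] -/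
theorem norm_fieldVec_iterate_sq_le (S : SchwingerFamily (EuclideanSpace ℝ (Fin 4)))
    (h : OSReconstructionNoE1 S.toLabelled)
    (hcone : ∀ (ψ : h.Hilbert) (μ : Measure (EuclideanSpace ℝ (Fin 4))),
      h.IsJointSpectralMeasure ψ μ → μ {p | p 0 < |p 1|} = 0)
    (M : ℕ) (C : ℝ) (hS : ∀ F, ‖S 2 F‖ ≤ C * schwartzNorm M F)
    (N : ℕ) {δ : ℝ} (hδ : 0 < δ) (hδ1 : δ ≤ 1)
    (g : 𝓢(EuclideanSpace ℝ (Fin 4), ℂ)) (hg : tsupport (g : EuclideanSpace ℝ (Fin 4) → ℂ) ⊆ {y | δ < y 0})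
    {w : EuclideanSpace ℝ (Fin 4)} (hw : w = EuclideanSpace.single (0 : Fin 4) (1 : ℝ) ∨
      w = EuclideanSpace.single (1 : Fin 4) (1 : ℝ))
    (hq : IsTimeOrdered (SchwartzMap.tensorFin 1 ![((∂_{w} : 𝓢(EuclideanSpace ℝ (Fin 4), ℂ) →
        𝓢(EuclideanSpace ℝ (Fin 4), ℂ))^[N] g)])) :
    ‖h.fieldVec 1 (fun _ => ()) _ hq‖ ^ 2 ≤
      ((2 * N : ℕ) / (Real.exp 1 * (δ / 2))) ^ (2 * N) *
        (2 * (|C| * (2 ^ (M + 1)) ^ 2 * 16 ^ M) * schwartzNorm M g ^ 2) :=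
  (norm_fieldVec_sq_le h hq).trans (norm_two_point_star_iterate_le S h hcone M C hS N hδ hδ1 g hg hw)

end FieldVecDeriv

end Summit.QuantumFields.YangMills.Theorems.TemperedCurvatureMoments.Sketch.ThreePointChartBounds

end
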